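import Literature.Claims.NS.Dahlke2026
import HarnessLib

/-!
# C165 `Dahlke2026` — the abstract «Discrete convexity iteration» (Lemma 15.7) is false

Cell `ns-claims` (D-0090 NS-CLAIMS SWEEP), row C165, text of record Zenodo 18905486 (v10, 73 pp.;
PDF page = printed page). Refuter of record ns-claims-refuter-2 g7; built on the typed skeleton
`Literature/Claims/NS/Dahlke2026.lean` (ns-claims-typist-6 g6, p538219, sha16 cad4bba4b25b54f9).

The skeleton's binder `h157 : Step_L157` of `claim_of_steps` (l.324; the third binder in dependency
order, consumed by `thm27_of_steps` l.301 with `X_j = M_j`, exactly as Theorem 15.8's proof p.64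
l.67–76 «We apply Lemma 15.7 with X_j = M_j») is **Lemma 15.7 p.64 l.7–20 typed VERBATIM at its
printed abstract grain**:

«Let (X_j)_{j≥j0} be a sequence of nonnegative numbers and let C1 ≥ 1, θ ∈ (0, 1). Assume that for all
integers j ≥ j0 + 1 we have X_j ≤ C1 X_{j−1}^θ X_{j+1}^{1−θ} + C1 B (15.12) for some B ≥ 0. Then there
exists a constant C2 = C2(C1, θ) such that sup_{j≥j0} X_j ≤ C2 (X_{j0} + B).»

This is false: the three-term log-convexity inequality (15.12) does not see the difference between a
sequence and its increasing rearrangements — geometric growth satisfies it with room to spare.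

* **W-cap (bounded family, `(C1, θ) = (2, 1/2)`, any `B ≥ 0`)**: `X_j = 4^{min(j,N)}`. For `j ≥ 1`,
  `X_j ≤ 2·X_{j−1}^{1/2}·X_{j+1}^{1/2}` (from `2^{min(j,N)} ≤ 2·2^{min(j−1,N)}` and
  `2^{min(j,N)} ≤ 2^{min(j+1,N)}`), so (15.12) holds at every `j ≥ j0 + 1 = 1`; but `X_N = 4^N` while
  `C2 (X_0 + B) = C2 (1 + B)` — no `C2` serves all `N` (`cap_counterexample`, `not_stepL157_two_half`).
  The witness is a bounded nonnegative sequence and the printed side conditions `C1 ≥ 1`,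
  `θ ∈ (0,1)`, `B ≥ 0` are all met; nothing degenerate is used.
* **W-exp (every admissible `(C1, θ)`, `B = 0`)**: `X_j = exp(r^j)`, `r = 2/(1−θ)`: since
  `(1−θ) r² − r + θ ≥ 0`, `r^j ≤ θ r^{j−1} + (1−θ) r^{j+1}`, i.e. `X_j ≤ X_{j−1}^θ X_{j+1}^{1−θ} ≤
  C1 X_{j−1}^θ X_{j+1}^{1−θ} + C1 B`; and `X_N = exp(r^N) > 2^N` outruns `C2 (X_0 + 0) = C2·e`
  (`not_stepL157_at`): the pointwise face fails at EVERY `C1 ≥ 1`, `θ ∈ (0,1)` — in particular at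
  whatever constants (15.11) p.64 l.1–5 would deliver.

Headline: `not_Step_L157 : ¬ Literature.Claims.NS.Dahlke2026.Step_L157`.

Records (prose, refuter's reading of the print; no kernel content is claimed for them): the §2
printing Lemma 2.5 «Barrier» p.11 l.52–59 (j ∈ ℤ, summable tails b_j, anchor (2.19) at large scales),
read at the same abstract grain, falls to the two-sided peak `X_j = c` (j ≤ 0), `c·4^j` (0 ≤ j ≤ N),
`c·4^{2N−j}` (j ≥ N) with `C = 4`, `ϑ = 1/2`, `b ≡ 0`, `c = A·E0`: (2.20) holds at every `j ∈ ℤ`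
(equality at the peak), the anchor (2.19) holds, and `sup_j X_j = 4^N·A·E0`; anchoring at large scales
and decay to `0` at small scales do not repair the iteration. The earlier binders `h153 : Step_Thm153` (P1 = Thm 15.3 p.63 l.1–16; Remark 15.6 p.63
l.47–55 calls P1 «a quantitative reformulation of the global regularity problem») and `h1511 :
Step_1511` (the printed implication «Theorem 15.3 implies (15.11)» p.64 l.1–5) carry no kernel object
here either way.

WHAT THIS IS NOT: not a claim about NS regularity or blow-up; not a claim about any author beyond the
typed locator.
-/

set_option linter.dupNamespace false

noncomputable section

open Real

namespace Summit.NavierStokesRegularity.NavierStokesRegularity.Theorems.Dahlke2026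

/-! ### W-cap: `X_j = 4^{min(j,N)} = (2^{min(j,N)})²` at `(C1, θ) = (2, 1/2)` -/

/-- kit lemma (plumbing): one dyadic step up costs at most a factor `2`. [folklore] -/
theorem two_pow_min_le_two_mul (N j : ℕ) (hj : 1 ≤ j) :
    (2 : ℝ) ^ (min j N) ≤ 2 * (2 : ℝ) ^ (min (j - 1) N) := by
  have h : min j N ≤ min (j - 1) N + 1 := by omega
  calc (2 : ℝ) ^ (min j N) ≤ 2 ^ (min (j - 1) N + 1) := pow_le_pow_right₀ (by norm_num) h
    _ = 2 * 2 ^ (min (j - 1) N) := by rw [pow_succ]; ring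

/-- kit lemma (plumbing): the capped dyadic family is monotone. [folklore] -/
theorem two_pow_min_mono (N j : ℕ) : (2 : ℝ) ^ (min j N) ≤ (2 : ℝ) ^ (min (j + 1) N) :=
  pow_le_pow_right₀ (by norm_num) (by omega)

/-- **The capped family satisfies (15.12) with `(C1, θ) = (2, 1/2)` and any `B ≥ 0`, at every `j ≥ 1`.**
[cite: Dahlke2026, Lemma 15.7 (15.12) p.64 l.7–16] -/
theorem cap_hyp (N : ℕ) {B : ℝ} (hB : 0 ≤ B) (j : ℕ) (hj : 1 ≤ j) :
    ((2 : ℝ) ^ (min j N)) ^ 2 ≤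
      2 * (((2 : ℝ) ^ (min (j - 1) N)) ^ 2) ^ (1 / 2 : ℝ) *
          (((2 : ℝ) ^ (min (j + 1) N)) ^ 2) ^ (1 - 1 / 2 : ℝ) + 2 * B := by
  have hs1 : (((2 : ℝ) ^ (min (j - 1) N)) ^ 2) ^ (1 / 2 : ℝ) = (2 : ℝ) ^ (min (j - 1) N) := by
    rw [← Real.sqrt_eq_rpow, Real.sqrt_sq (by positivity)]
  have hs2 : (((2 : ℝ) ^ (min (j + 1) N)) ^ 2) ^ (1 / 2 : ℝ) = (2 : ℝ) ^ (min (j + 1) N) := by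
    rw [← Real.sqrt_eq_rpow, Real.sqrt_sq (by positivity)]
  rw [show (1 - 1 / 2 : ℝ) = 1 / 2 by norm_num, hs1, hs2, sq]
  have h1 := two_pow_min_le_two_mul N j hj
  have h2 := two_pow_min_mono N j
  have h3 : (0 : ℝ) < (2 : ℝ) ^ (min (j - 1) N) := by positivity
  nlinarith [mul_le_mul h1 h2 (by positivity) (by positivity)]

/-- **For every candidate constant `C2` and every `B ≥ 0` some member of the capped family obeys (15.12)
(with `C1 = 2`, `θ = 1/2`, `j0 = 0`) and violates the conclusion at `j = N`: `X_N = 4^N > C2 (X_0 + B)`.**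
[cite: Dahlke2026, Lemma 15.7 p.64 l.7–20] -/
theorem cap_counterexample (C₂ B : ℝ) (hB : 0 ≤ B) :
    ∃ N : ℕ, (∀ j : ℕ, 0 + 1 ≤ j →
        ((2 : ℝ) ^ (min j N)) ^ 2 ≤
          2 * (((2 : ℝ) ^ (min (j - 1) N)) ^ 2) ^ (1 / 2 : ℝ) *
              (((2 : ℝ) ^ (min (j + 1) N)) ^ 2) ^ (1 - 1 / 2 : ℝ) + 2 * B) ∧
      ¬ ((2 : ℝ) ^ (min N N)) ^ 2 ≤ C₂ * (((2 : ℝ) ^ (min 0 N)) ^ 2 + B) := by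
  obtain ⟨N, hN⟩ := pow_unbounded_of_one_lt (C₂ * (1 + B)) (by norm_num : (1 : ℝ) < 4)
  refine ⟨N, fun j hj => cap_hyp N hB j (by omega), ?_⟩
  have hNN : ((2 : ℝ) ^ (min N N)) ^ 2 = 4 ^ N := by
    rw [min_self, ← pow_mul, mul_comm, pow_mul]; norm_num
  rw [hNN, Nat.zero_min, pow_zero, one_pow]
  exact not_le.2 hN

/-- **Lemma 15.7 fails at `(C1, θ) = (2, 1/2)`** (bounded witness family `X_j = 4^{min(j,N)}`, `B = 0`,
`j0 = 0`). [cite: Dahlke2026, Lemma 15.7 p.64 l.7–20] -/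
theorem not_stepL157_two_half :
    ¬ ∃ C₂ : ℝ, ∀ (X : ℕ → ℝ) (j₀ : ℕ) (B : ℝ), (∀ j, 0 ≤ X j) → 0 ≤ B →
      (∀ j : ℕ, j₀ + 1 ≤ j →
          X j ≤ 2 * X (j - 1) ^ (1 / 2 : ℝ) * X (j + 1) ^ (1 - 1 / 2 : ℝ) + 2 * B) →
        ∀ j : ℕ, j₀ ≤ j → X j ≤ C₂ * (X j₀ + B) := by
  rintro ⟨C₂, h⟩
  obtain ⟨N, hhyp, hfail⟩ := cap_counterexample C₂ 0 le_rfl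
  exact hfail (h (fun j => ((2 : ℝ) ^ (min j N)) ^ 2) 0 0 (fun j => by positivity) le_rfl hhyp N
    (Nat.zero_le N))

/-! ### W-exp: `X_j = exp(r^j)`, `r = 2/(1−θ)` — every admissible `(C1, θ)` -/

/-- **The exponential family satisfies (15.12) for every `C1 ≥ 1`, `θ ∈ (0,1)`, `B ≥ 0`, at every
`j ≥ 1`** (`r^j ≤ θ r^{j−1} + (1−θ) r^{j+1}` from `(1−θ) r = 2`). [cite: Dahlke2026, Lemma 15.7 (15.12) p.64 l.7–16] -/
theorem exp_hyp {C₁ θ : ℝ} (hC₁ : 1 ≤ C₁) (hθ0 : 0 < θ) (hθ1 : θ < 1) {B : ℝ} (hB : 0 ≤ B)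
    (j : ℕ) (hj : 1 ≤ j) :
    Real.exp ((2 / (1 - θ)) ^ j) ≤
      C₁ * Real.exp ((2 / (1 - θ)) ^ (j - 1)) ^ θ * Real.exp ((2 / (1 - θ)) ^ (j + 1)) ^ (1 - θ)
        + C₁ * B := by
  set r : ℝ := 2 / (1 - θ) with hr
  have h1θ : 0 < 1 - θ := by linarith
  have hr0 : 0 < r := by positivity
  have hrr : (1 - θ) * r = 2 := by rw [hr]; field_simp
  obtain ⟨m, rfl⟩ : ∃ m, j = m + 1 := ⟨j - 1, by omega⟩
  have hm : m + 1 - 1 = m := by omega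
  rw [hm, ← Real.exp_mul, ← Real.exp_mul, mul_assoc, ← Real.exp_add]
  have hexp : r ^ (m + 1) ≤ r ^ m * θ + r ^ (m + 1 + 1) * (1 - θ) := by
    have hrm : 0 ≤ r ^ m := by positivity
    have : r ≤ θ + r ^ 2 * (1 - θ) := by nlinarith
    calc r ^ (m + 1) = r ^ m * r := pow_succ r m
      _ ≤ r ^ m * (θ + r ^ 2 * (1 - θ)) := mul_le_mul_of_nonneg_left this hrm
      _ = r ^ m * θ + r ^ (m + 1 + 1) * (1 - θ) := by ring
  calc Real.exp (r ^ (m + 1)) ≤ Real.exp (r ^ m * θ + r ^ (m + 1 + 1) * (1 - θ)) :=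
        Real.exp_le_exp.2 hexp
    _ = 1 * Real.exp (r ^ m * θ + r ^ (m + 1 + 1) * (1 - θ)) + 1 * 0 := by ring
    _ ≤ C₁ * Real.exp (r ^ m * θ + r ^ (m + 1 + 1) * (1 - θ)) + C₁ * B := by
        gcongr

/-- **The pointwise face of Lemma 15.7 fails at EVERY admissible pair of constants** `C1 ≥ 1`,
`θ ∈ (0,1)` (witness `X_j = exp((2/(1−θ))^j)`, `B = 0`, `j0 = 0`): in particular at whatever constants
(15.11) p.64 l.1–5 would supply. [cite: Dahlke2026, Lemma 15.7 p.64 l.7–20; (15.11) p.64 l.1–5] -/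
theorem not_stepL157_at {C₁ θ : ℝ} (hC₁ : 1 ≤ C₁) (hθ0 : 0 < θ) (hθ1 : θ < 1) :
    ¬ ∃ C₂ : ℝ, ∀ (X : ℕ → ℝ) (j₀ : ℕ) (B : ℝ), (∀ j, 0 ≤ X j) → 0 ≤ B →
      (∀ j : ℕ, j₀ + 1 ≤ j → X j ≤ C₁ * X (j - 1) ^ θ * X (j + 1) ^ (1 - θ) + C₁ * B) →
        ∀ j : ℕ, j₀ ≤ j → X j ≤ C₂ * (X j₀ + B) := by
  rintro ⟨C₂, h⟩
  set r : ℝ := 2 / (1 - θ) with hr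
  have h1θ : 0 < 1 - θ := by linarith
  have hr2 : 2 ≤ r := by
    rw [hr, le_div_iff₀ h1θ]; nlinarith
  obtain ⟨N, hN⟩ := pow_unbounded_of_one_lt (C₂ * (Real.exp 1 + 0)) (by norm_num : (1 : ℝ) < 2)
  have key := h (fun j => Real.exp (r ^ j)) 0 0 (fun j => (Real.exp_pos _).le) le_rfl
    (fun j hj => exp_hyp hC₁ hθ0 hθ1 le_rfl j (by omega)) N (Nat.zero_le N)
  simp only [pow_zero] at key
  have h2N : (2 : ℝ) ^ N ≤ r ^ N := pow_le_pow_left₀ (by norm_num) hr2 N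
  have : (2 : ℝ) ^ N < Real.exp (r ^ N) :=
    lt_of_le_of_lt h2N (by linarith [Real.add_one_le_exp (r ^ N)])
  linarith

/-! ### Headline -/

/-- **Refutes `Literature.Claims.NS.Dahlke2026.Step_L157`** [refuted-substantive] — Lemma 15.7
(Discrete convexity iteration) p.64 l.7–20, typed verbatim at its abstract real-sequence grain and
consumed as binder `h157` of `claim_of_steps` (l.324) exactly as Thm 15.8's proof p.64 l.67–76 consumes
it: the bounded sequence `X_j = 4^{min(j,N)}` with `C1 = 2`, `θ = 1/2`, `B = 0`, `j0 = 0` satisfies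
(15.12) at every `j ≥ 1` and has `X_N / (X_0 + B) = 4^N`, so no `C2 = C2(C1, θ)` exists; the
exponential family (`not_stepL157_at`) shows the same at every admissible `(C1, θ)`. No cheap repair:
restricting to bounded sequences, to sequences decaying to `0` (two-sided peak, `C1 = 4`), to `B > 0`
(`cap_counterexample`), or anchoring at large scales as in Lemma 2.5 (2.19) leaves the witness pattern
intact; the conclusion needs a monotonicity-type hypothesis on `(X_j)` that (15.11) does not provide.
barrier-candidate: none (an arithmetic slip, not a technique class).
[cite: Dahlke2026, Lemma 15.7 p.64 l.7–20; Thm 15.8 proof p.64 l.67–76] -/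
theorem not_Step_L157 : ¬ Literature.Claims.NS.Dahlke2026.Step_L157 := fun h =>
  not_stepL157_two_half (h 2 (by norm_num) (1 / 2) (by norm_num) (by norm_num))

/-- The same refutation through the exponential family (every `(C1, θ)`; here read at `(1, 1/2)`:
pure log-convexity `X_j ≤ X_{j−1}^{1/2} X_{j+1}^{1/2}` already fails to bound the sequence).
[cite: Dahlke2026, Lemma 15.7 p.64 l.7–20] -/
theorem not_Step_L157' : ¬ Literature.Claims.NS.Dahlke2026.Step_L157 := fun h =>
  not_stepL157_at (C₁ := 1) (θ := 1 / 2) le_rfl (by norm_num) (by norm_num)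
    (h 1 le_rfl (1 / 2) (by norm_num) (by norm_num))

end Summit.NavierStokesRegularity.NavierStokesRegularity.Theorems.Dahlke2026

end

-- WHAT THIS IS NOT: not a claim about NS regularity or blow-up; not a claim about any author beyond the
-- typed locator.
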